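import Mathlib
import HarnessLib
import Summits.HubbardSuperconductivity.HubbardSuperconductivity.Theorems.KLProgrammeKLRegimeTwoVolumeTowerSpineStep
import Summits.HubbardSuperconductivity.HubbardSuperconductivity.Theorems.KLProgrammeKLRegimeTwoVolumeTransferTailsWt
import Summits.HubbardSuperconductivity.HubbardSuperconductivity.Theorems.KLProgrammeKLRegimeTwoVolumeSubstitutionGluingDeepPin
import Summits.HubbardSuperconductivity.HubbardSuperconductivity.Theorems.KLProgrammeKLRegimeTwoVolumeDataKitWt
import Summits.HubbardSuperconductivity.HubbardSuperconductivity.Theorems.KLProgrammeKLRegimeTwoVolumeDoubledBlockData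

/-!
# Route `KLProgramme` — crux K3, VL child `KLRegimeVolumeLimitV17F2` (stmt-HubbardSuperconductivity-20440), blueprint v5 M5 / W6a: THE END TRANSFER — the
# keyed two-volume defect of the top states carried through the common-frame transfer (seat hubbard-kl-k3c4-p1 g13; `--supports` 20440)

The END of the nested two-volume induction reads `klTowerD V … K_V J = map (klTowerTransfer V … K_V J) (klTowerState V … K_V J)` (no integration).  This file
transfers the spine's output (the keyed defect of the two top STATES at the `D₀`-deep pins) through the transfer AT THE COMMON (coarse) FRAME `Kc`:

* **`klTowerTransfer_periodise`** — the two volumes' transfers at a common frame are related by the doubled periodisation identity (fine preimage sums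
  over a residue fibre = coarse entry), at every step `j` (`j = 0`: identity; `j ≥ 1`: `klReanalysis ⊕ klSlotShift`, `…TowerDefs` §5 + `doubleBlock_periodise`);
* **`tower_keyedDefect_map_transfer_le`** — for the cross bundle `TowerCrossData` (transfer rows/columns with the `Λ_T`-scaled weight, block covariance),
  the raw `Λ_{J−1}`-weighted profiles `ε·NS J` of the two states, and any majorant `ε·Ej` of their keyed defect at the `D₀`-deep pins (`2r ≤ D₀`): at every
  `(D₀ + r)`-deep pin `w` and degree `n+1`,
  `Σ_{X p = w} ‖kernel (map T″[Kc] state″_J) X − [one block]·kernel (map T[Kc] state_J) (residues X)‖ ≤ ε·tb_J(n)`,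
  `tb_J(n) = cWⁿ(cW·Ej(n+1) + τ·2NS J(n+1)) + 2cWⁿτ·NS J(n+1) + n·cWⁿ(5τ·NS J(n+1) + 2cW·(1+Λ_{J−1}(r+1))⁻¹NS J(n+1))`, `τ = cW/(1 + Λ_T(r+1))` — the transfer
  half of the per-scale step (`…SubstitutionGluingDeepPin.sum_norm_kernel_map_sub_glue_map_le_of_defect` with the nine data of `…TransferTailsWt`).

Proofs only; no definition.
-/

noncomputable section

namespace Summit.HubbardSuperconductivity.HubbardSuperconductivity.Theorems.TwoVolumeSource

set_option linter.dupNamespace false -- summit = problem name (single-conjunct summit), D-0017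

open Finset Literature.MathematicalPhysics.QuantumLattice GrassmannAlgebra Literature.Probability.LatticeModels
  Literature.Probability.LatticeModels.BattleFederbush
open Summit.HubbardSuperconductivity.HubbardSuperconductivity.Theorems.TwoPointAssembly
open Summit.HubbardSuperconductivity.HubbardSuperconductivity.Theorems.KLRegimeSplit
open Summit.HubbardSuperconductivity.HubbardSuperconductivity.Theorems.KLProgrammeLegKernels
open Summit.HubbardSuperconductivity.HubbardSuperconductivity.Theorems.EngineV8
open Summit.HubbardSuperconductivity.HubbardSuperconductivity.Theorems.TwoVolumeDefect

/-! ## §1 The transfers of two volumes at a common frame are related by periodisation -/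

/-- **The doubled periodisation identity of `klTowerTransfer`** at two volumes `L`, `L″ = bL` and a common frame `K`, every step `j`. [folklore] -/
theorem klTowerTransfer_periodise {b L Lf M : ℕ} [NeZero L] [NeZero Lf] [NeZero M] (hLf : Lf = b * L) {β : ℝ} (hβ : β ≠ 0) (μ : ℝ) (K : TrigPolyC4v) (j : ℕ)
    (e : (SpaceTimeIdx Lf M × SectorLeg (sectorCount j)) ≃ (Fin 2 → Fin b) × (SpaceTimeIdx L M × SectorLeg (sectorCount j)))
    (he2 : ∀ X', (e X').2 = ((X'.1.1, fun i => (((X'.1.2 i).val : ℕ) : ZMod L)), X'.2))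
    (ed : SrcLabel Lf M j ≃ (Fin 2 → Fin b) × SrcLabel L M j) (hed : ∀ x s, ed (x, s) = ((e x).1, ((e x).2, s)))
    (e₁ : (SpaceTimeIdx Lf M × SectorLeg (sectorCount (j - 1))) ≃ (Fin 2 → Fin b) × (SpaceTimeIdx L M × SectorLeg (sectorCount (j - 1))))
    (he₁2 : ∀ X', (e₁ X').2 = ((X'.1.1, fun i => (((X'.1.2 i).val : ℕ) : ZMod L)), X'.2))
    (ed₁ : SrcLabel Lf M (j - 1) ≃ (Fin 2 → Fin b) × SrcLabel L M (j - 1)) (hed₁ : ∀ x s, ed₁ (x, s) = ((e₁ x).1, ((e₁ x).2, s)))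
    (X' : SrcLabel Lf M j) (Y : SrcLabel L M (j - 1)) :
    ∑ Y'' ∈ univ.filter (fun Y'' : SrcLabel Lf M (j - 1) => (ed₁ Y'').2 = Y), klTowerTransfer Lf M β μ K j X' Y'' =
      klTowerTransfer L M β μ K j (ed X').2 Y := by
  cases j with
  | zero =>
    refine doubleBlock_periodise e₁ e ed₁ hed₁ ed hed 1 1 1 1 (klTowerTransfer L M β μ K 0) (klTowerTransfer Lf M β μ K 0)
      (fun p' p => by rw [klTowerTransfer_zero]; exact one_srcLabel_apply p' p)
      (fun p' p => by rw [klTowerTransfer_zero]; exact one_srcLabel_apply p' p) (fun X' Y => ?_) (fun X' Y => ?_) X' Y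
    · rw [one_periodise e₁ X' Y]
      have he : (e₁ X').2 = (e X').2 := by rw [he₁2, he2]
      rw [he]
    · rw [one_periodise e₁ X' Y]
      have he : (e₁ X').2 = (e X').2 := by rw [he₁2, he2]
      rw [he]
  | succ k =>
    exact doubleBlock_periodise e₁ e ed₁ hed₁ ed hed (klReanalysis L M β μ K k) (klSlotShift L M k) (klReanalysis Lf M β μ K k) (klSlotShift Lf M k)
      (klTowerTransfer L M β μ K (k + 1)) (klTowerTransfer Lf M β μ K (k + 1))
      (fun p' p => by rw [klTowerTransfer_succ]; exact klSrcTransfer_apply β μ K k p' p)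
      (fun p' p => by rw [klTowerTransfer_succ]; exact klSrcTransfer_apply β μ K k p' p)
      (fun X' Y => klReanalysis_periodise hLf hβ μ K k e he2 e₁ he₁2 X' Y) (fun X' Y => klSlotShift_periodise k e he2 e₁ he₁2 X' Y) X' Y

/-! ## §2 The keyed defect of the top states through the common-frame transfer -/

set_option maxHeartbeats 400000 in -- the nine transfer data and the gluing bracket in one declaration
/-- **THE END TRANSFER** (see the module docstring). [folklore: the transfer half of the per-scale step; cite: BenfattoGiulianiMastropietro2006, §3 (3.2)-(3.8)] -/
theorem tower_keyedDefect_map_transfer_le {L b M : ℕ} [NeZero L] [NeZero (b * L)] [NeZero M] (β U μ : ℝ) (hβ : β ≠ 0) (Kc Kf : TrigPolyC4v) (J : ℕ)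
    {ε : ℝ} (hε : 0 < ε) (Λ κ' aW' sW' eW' ΛT cW κf sE cR cC δ : ℕ → ℝ) (NS : ℕ → ℕ → ℝ)
    (hX : TowerCrossData L b M β μ Kc Kf J ε Λ κ' aW' sW' eW' ΛT cW κf sE cR cC δ) (hΛ₁ : 0 ≤ Λ (J - 1)) (hNSJ0 : ∀ k, 0 ≤ NS J k)
    (hSc : WtProfileRaw (klTowerState L M β U μ Kc J) (Λ (J - 1)) (fun k => ε * NS J k))
    (hSf : WtProfileRaw (klTowerState (b * L) M β U μ Kf J) (Λ (J - 1)) (fun k => ε * NS J k))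
    (D₀ r : ℕ) (hD₀ : 2 * r ≤ D₀) (Ej : ℕ → ℝ) (hEj0 : ∀ k, 0 ≤ Ej k)
    (hEj : ∀ (k : ℕ) (p' : Fin k) (y' : SrcLabel (b * L) M (J - 1)), (∀ i, D₀ ≤ (y'.1.1.2 i).val % L ∧ (y'.1.1.2 i).val % L + D₀ < L) →
      klKeyedDefect L b M β U μ Kc Kf J k p' y' ≤ ε * Ej k)
    (n : ℕ) (p : Fin (n + 1)) (w : SrcLabel (b * L) M J) (hw : ∀ i, D₀ + r ≤ (w.1.1.2 i).val % L ∧ (w.1.1.2 i).val % L + (D₀ + r) < L) :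
    ∑ X ∈ univ.filter (fun X : Fin (n + 1) → SrcLabel (b * L) M J => X p = w),
        ‖kernel ℂ (ExteriorAlgebra.map (Matrix.toLin' (klTowerTransfer (b * L) M β μ Kc J)) (klTowerState (b * L) M β U μ Kf J)) (n + 1) X -
          (if ∀ i, (klBlockEquivD L b M J (X i)).1 = (klBlockEquivD L b M J (X p)).1 then
            kernel ℂ (ExteriorAlgebra.map (Matrix.toLin' (klTowerTransfer L M β μ Kc J)) (klTowerState L M β U μ Kc J)) (n + 1)
              (fun i => (klBlockEquivD L b M J (X i)).2) else 0)‖ ≤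
      ε * (cW J ^ n * (cW J * Ej (n + 1) + cW J / (1 + ΛT J * ((r : ℝ) + 1)) * (NS J (n + 1) + NS J (n + 1))) +
        (2 * cW J ^ n * (cW J / (1 + ΛT J * ((r : ℝ) + 1))) * NS J (n + 1) +
          (n : ℝ) * cW J ^ n * (5 * (cW J / (1 + ΛT J * ((r : ℝ) + 1))) * NS J (n + 1) + 2 * cW J * ((1 + Λ (J - 1) * ((r : ℝ) + 1))⁻¹ * NS J (n + 1))))) := by
  classical
  -- §0 names, signs, the block structures
  haveI : NeZero b := ⟨fun h => NeZero.ne (b * L) (by rw [h, zero_mul])⟩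
  set ed := klBlockEquivD L b M J with hed_def
  set ed₁ := klBlockEquivD L b M (J - 1) with hed₁_def
  set Tpf := klTowerTransfer (b * L) M β μ Kc J with hTpf_def
  set Tpc := klTowerTransfer L M β μ Kc J with hTpc_def
  set 𝒲' := klTowerState (b * L) M β U μ Kf J with h𝒲'_def
  set 𝒲 := klTowerState L M β U μ Kc J with h𝒲_def
  have htr := hX.transfer J le_rfl
  have hΛT := htr.ΛT_nonneg
  have hcW := htr.cW_nonneg
  have hrowT : ∀ x : SrcLabel (b * L) M J, ∑ y', ‖Tpf x y'‖ * (1 + ΛT J * (Torus.tnorm (x.1.1.2 - y'.1.1.2) : ℝ)) ≤ cW J := htr.row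
  have hcolT : ∀ y' : SrcLabel (b * L) M (J - 1), ∑ x, ‖Tpf x y'‖ * (1 + ΛT J * (Torus.tnorm (x.1.1.2 - y'.1.1.2) : ℝ)) ≤ cW J := htr.col
  have hcovT : ∀ (δ β' β : Fin 2 → Fin b) (xbar : SrcLabel L M J) (y : SrcLabel L M (J - 1)),
      ‖Tpf (ed.symm (β' + δ, xbar)) (ed₁.symm (β + δ, y))‖ = ‖Tpf (ed.symm (β', xbar)) (ed₁.symm (β, y))‖ := htr.cov
  have hed1 : ∀ (x : SrcLabel (b * L) M J) i, ((ed x).1 i : ℕ) = (x.1.1.2 i).val / L := fun x i => by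
    obtain ⟨x, s⟩ := x; rw [hed_def, klBlockEquivD_apply]; exact klBlockEquiv_val L b M _ x i
  have hed₁1 : ∀ (y' : SrcLabel (b * L) M (J - 1)) i, ((ed₁ y').1 i : ℕ) = (y'.1.1.2 i).val / L := fun y' i => by
    obtain ⟨y, s⟩ := y'; rw [hed₁_def, klBlockEquivD_apply]; exact klBlockEquiv_val L b M _ y i
  have hed2s : ∀ x : SrcLabel (b * L) M J, (fun Y : SrcLabel L M J => Y.1.1.2) (ed x).2 = fun i => ((((x.1.1.2 i).val : ℕ)) : ZMod L) := fun x => by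
    obtain ⟨x, s⟩ := x; rw [hed_def, klBlockEquivD_apply]; dsimp only; rw [klBlockEquiv_snd]
  have hed₁2s : ∀ y' : SrcLabel (b * L) M (J - 1), (fun Y : SrcLabel L M (J - 1) => Y.1.1.2) (ed₁ y').2 = fun i => ((((y'.1.1.2 i).val : ℕ)) : ZMod L) :=
    fun y' => by obtain ⟨y, s⟩ := y'; rw [hed₁_def, klBlockEquivD_apply]; dsimp only; rw [klBlockEquiv_snd]
  -- §1 the nine transfer data (`aT := cW`, `τT := cW/(1+Λ_T(r+1))`), regions `R := D₀ + r`, `RN := r`, `RZ := 2r`, `RF := r`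
  have hτT : 0 ≤ cW J / (1 + ΛT J * ((r : ℝ) + 1)) := by positivity
  have hTcol := transfer_col_le (fun x : SrcLabel (b * L) M J => x.1.1.2) (fun y' : SrcLabel (b * L) M (J - 1) => y'.1.1.2) Tpf hΛT hcolT
  have hTwin := transfer_win_le (fun x : SrcLabel (b * L) M J => x.1.1.2) (fun y' : SrcLabel (b * L) M (J - 1) => y'.1.1.2) Tpf hΛT hcolT ed ed₁ hcovT
  have hTρ := transfer_rho_le (fun x : SrcLabel (b * L) M J => x.1.1.2) (fun y' : SrcLabel (b * L) M (J - 1) => y'.1.1.2) Tpf hΛT hrowT ed ed₁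
  have hTrowF := transfer_rowF_le (fun x : SrcLabel (b * L) M J => x.1.1.2) (fun y' : SrcLabel (b * L) M (J - 1) => y'.1.1.2) Tpf hΛT hrowT r
  have hTτF := transfer_tauF_le (fun x : SrcLabel (b * L) M J => x.1.1.2) (fun y' : SrcLabel (b * L) M (J - 1) => y'.1.1.2) Tpf hΛT hrowT hcW (le_refl r)
  have hTτ2 := transfer_tau2_le (fun x : SrcLabel (b * L) M J => x.1.1.2) (fun y' : SrcLabel (b * L) M (J - 1) => y'.1.1.2) Tpf hΛT hrowT hcW
    (rfl : b * L = b * L) ed ed₁ hed1 hed₁1 (Nat.le_add_left r D₀) w hw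
  have hTτ3 := transfer_tau3_le (fun x : SrcLabel (b * L) M J => x.1.1.2) (fun y' : SrcLabel (b * L) M (J - 1) => y'.1.1.2) Tpf hΛT hrowT hcW
    (rfl : b * L = b * L) ed ed₁ (fun Y : SrcLabel L M J => Y.1.1.2) (fun Y : SrcLabel L M (J - 1) => Y.1.1.2) hed2s hed₁2s (le_refl r) w
  have hTτ1 := transfer_tau1_le (fun x : SrcLabel (b * L) M J => x.1.1.2) (fun y' : SrcLabel (b * L) M (J - 1) => y'.1.1.2) Tpf hΛT hcolT
    (rfl : b * L = b * L) ed ed₁ hed1 hed₁1 (fun Y : SrcLabel L M J => Y.1.1.2) (fun Y : SrcLabel L M (J - 1) => Y.1.1.2) hed2s hed₁2s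
    (RZ := 2 * r) (by omega : r + 2 * r ≤ D₀ + r) w hw
  have hTτ4 := transfer_tau4_le (fun x : SrcLabel (b * L) M J => x.1.1.2) (fun y' : SrcLabel (b * L) M (J - 1) => y'.1.1.2) Tpf hΛT hcolT
    (rfl : b * L = b * L) ed ed₁ hed1 hed₁1 (fun Y : SrcLabel L M J => Y.1.1.2) (fun Y : SrcLabel L M (J - 1) => Y.1.1.2) hed2s hed₁2s hcovT
    (RZ := 2 * r) (by omega : r + 2 * r ≤ D₀ + r) w hw
  -- §2 the block embeddings and the periodisation of the transfers
  set Fe : (Fin 2 → Fin b) → (SrcLabel L M J → ℂ) →ₗ[ℂ] (SrcLabel (b * L) M J → ℂ) := fun β' =>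
    LinearMap.pi (fun X' : SrcLabel (b * L) M J => if (ed X').1 = β' then (LinearMap.proj (ed X').2 : (SrcLabel L M J → ℂ) →ₗ[ℂ] ℂ) else 0) with hFe_def
  have hFe : ∀ β' v X', Fe β' v X' = if (ed X').1 = β' then v (ed X').2 else 0 := fun β' v X' => blockEmb_pi_apply ℂ ed β' v X'
  set Fe₁ : (Fin 2 → Fin b) → (SrcLabel L M (J - 1) → ℂ) →ₗ[ℂ] (SrcLabel (b * L) M (J - 1) → ℂ) := fun β' =>
    LinearMap.pi (fun X' : SrcLabel (b * L) M (J - 1) => if (ed₁ X').1 = β' then (LinearMap.proj (ed₁ X').2 : (SrcLabel L M (J - 1) → ℂ) →ₗ[ℂ] ℂ) else 0)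
    with hFe₁_def
  have hFe₁ : ∀ β' v X', Fe₁ β' v X' = if (ed₁ X').1 = β' then v (ed₁ X').2 else 0 := fun β' v X' => blockEmb_pi_apply ℂ ed₁ β' v X'
  have hPT : ∀ (X' : SrcLabel (b * L) M J) (Y : SrcLabel L M (J - 1)),
      ∑ Y'' ∈ univ.filter (fun Y'' : SrcLabel (b * L) M (J - 1) => (ed₁ Y'').2 = Y), Tpf X' Y'' = Tpc (ed X').2 Y :=
    fun X' Y => klTowerTransfer_periodise (rfl : b * L = b * L) hβ μ Kc J (klBlockEquiv L b M (sectorCount J)) (klBlockEquiv_snd L b M _) ed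
      (klBlockEquivD_apply L b M J) (klBlockEquiv L b M (sectorCount (J - 1))) (klBlockEquiv_snd L b M _) ed₁ (klBlockEquivD_apply L b M (J - 1)) X' Y
  -- §3 the transfer triangle, the coarse profiles (plain and far), the two-volume data in glued form
  have hZT : ∀ y y' : SrcLabel L M (J - 1), Torus.tnorm ((ed w).2.1.1.2 - y.1.1.2) ≤ r → 2 * r < Torus.tnorm ((ed w).2.1.1.2 - y'.1.1.2) →
      r < Torus.tnorm (y.1.1.2 - y'.1.1.2) := by
    intro y y' hy hy'
    have htri := Torus.tnorm_add_le ((ed w).2.1.1.2 - y.1.1.2) (y.1.1.2 - y'.1.1.2)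
    rw [sub_add_sub_cancel] at htri; omega
  have hNj : ∀ y : SrcLabel L M (J - 1), ∑ Y ∈ univ.filter (fun Y : Fin (n + 1) → SrcLabel L M (J - 1) => Y p = y), ‖kernel ℂ 𝒲 (n + 1) Y‖ ≤ ε * NS J (n + 1) :=
    fun y => hSc.unweighted (n + 1) p y
  have hNfarj : ∀ (y : SrcLabel L M (J - 1)) (i : Fin (n + 1)),
      ∑ Y ∈ univ.filter (fun Y : Fin (n + 1) → SrcLabel L M (J - 1) => Y p = y ∧ r < Torus.tnorm ((Y p).1.1.2 - (Y i).1.1.2)), ‖kernel ℂ 𝒲 (n + 1) Y‖ ≤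
        (1 + Λ (J - 1) * ((r : ℝ) + 1))⁻¹ * (ε * NS J (n + 1)) :=
    fun y i => sum_far_norm_kernel_le_of_scaledWeighted (fun Y : SrcLabel L M (J - 1) => Y.1.1.2) 𝒲 hΛ₁ (n + 1) p y i r (hSc.le (n + 1) p y)
  have hsub₁ : ∀ (q : Fin (n + 1)) (Y' : Fin (n + 1) → SrcLabel (b * L) M (J - 1)),
      kernel ℂ (∑ β', ExteriorAlgebra.map (Fe₁ β') 𝒲) (n + 1) Y' = if ∀ i, (ed₁ (Y' i)).1 = (ed₁ (Y' q)).1 then kernel ℂ 𝒲 (n + 1) (fun i => (ed₁ (Y' i)).2) else 0 :=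
    fun q Y' => kernel_copies_sum ed₁ Fe₁ hFe₁ _ q Y'
  have hEj' : ∀ y' : SrcLabel (b * L) M (J - 1), Torus.tnorm (w.1.1.2 - y'.1.1.2) ≤ r →
      ∑ Y' ∈ univ.filter (fun Y' : Fin (n + 1) → SrcLabel (b * L) M (J - 1) => Y' p = y'),
        ‖kernel ℂ (𝒲' - ∑ β', ExteriorAlgebra.map (Fe₁ β') 𝒲) (n + 1) Y'‖ ≤ ε * Ej (n + 1) := by
    intro y' hy'
    simp only [kernel_sub', hsub₁ p]
    have hdeep := deepRes_of_tnorm_le (b := b) (m := L) (Mf := b * L) rfl hw hy'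
    have h := hEj (n + 1) p y' hdeep
    rw [klKeyedDefect_eq] at h
    exact h
  have hNDj' : ∀ y' : SrcLabel (b * L) M (J - 1),
      ∑ Y' ∈ univ.filter (fun Y' : Fin (n + 1) → SrcLabel (b * L) M (J - 1) => Y' p = y'),
        ‖kernel ℂ (𝒲' - ∑ β', ExteriorAlgebra.map (Fe₁ β') 𝒲) (n + 1) Y'‖ ≤ ε * (NS J (n + 1) + NS J (n + 1)) := by
    intro y'
    simp only [kernel_sub', hsub₁ p]
    have h := klKeyedDefect_le_of_wtProfileRaw β U μ Kc Kf J hSf hSc (n + 1) p y'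
    rw [klKeyedDefect_eq] at h
    exact h.trans (le_of_eq (by ring))
  -- §4 the gluing bracket
  have hsub : ∀ X : Fin (n + 1) → SrcLabel (b * L) M J,
      kernel ℂ (∑ β', ExteriorAlgebra.map (Fe β') (ExteriorAlgebra.map (Matrix.toLin' Tpc) 𝒲)) (n + 1) X =
        if ∀ i, (ed (X i)).1 = (ed (X p)).1 then kernel ℂ (ExteriorAlgebra.map (Matrix.toLin' Tpc) 𝒲) (n + 1) (fun i => (ed (X i)).2) else 0 :=
    fun X => kernel_copies_sum ed Fe hFe _ p X
  simp_rw [← hsub]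
  have hmain := sum_norm_kernel_map_sub_glue_map_le_of_defect ed₁ ed Tpc Tpf hPT Fe₁ hFe₁ Fe hFe 𝒲' 𝒲 p w
    (fun y : SrcLabel L M (J - 1) => 2 * r < Torus.tnorm ((ed w).2.1.1.2 - y.1.1.2))
    (fun y : SrcLabel L M (J - 1) => Torus.tnorm ((ed w).2.1.1.2 - y.1.1.2) ≤ r)
    (fun y y' : SrcLabel L M (J - 1) => r < Torus.tnorm (y.1.1.2 - y'.1.1.2)) hZT
    (fun y' : SrcLabel (b * L) M (J - 1) => Torus.tnorm (w.1.1.2 - y'.1.1.2) ≤ r)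
    hcW hτT (mul_nonneg hε.le (hNSJ0 _)) (mul_nonneg (inv_nonneg.2 (by positivity)) (mul_nonneg hε.le (hNSJ0 _))) (mul_nonneg hε.le (hEj0 _))
    (mul_nonneg hε.le (add_nonneg (hNSJ0 _) (hNSJ0 _)))
    hTcol hTwin (hTρ w) (hTrowF w) (hTτF w) (fun y hy => hTτ1 y hy) hTτ2 (hTτ3) (fun y hy => hTτ4 y hy) hNj hNfarj hEj' hNDj'
  refine hmain.trans (le_of_eq ?_)
  ring

end Summit.HubbardSuperconductivity.HubbardSuperconductivity.Theorems.TwoVolumeSource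

end
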